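import Summits.QuantumFields.YangMills.Theorems.LuscherReductionTwistedTraceScalingBTHaarFloor
import HarnessLib

/-!
# Small quaternion balls have polynomial Haar mass FROM ABOVE: `Haar{‖q(g) − 1‖ ≤ ρ} ≤ (π²/12)·ρ³ ≤ ρ³` (all `ρ ≥ 0`), and the gauge core `Haar^Λ(G_c(ρ)) ≤ ρ^{3|Λ|}`
# (tool for the log-free MOMENT analysis of the rate twin «ratepack-v3 / frozen fibres»; route `FlatTubeReduction`, crux K1 `NearFlatRatioLaw` stmt-QuantumFields-24720;
# seat `ym-line-ftr-p1` g12; R2b1 RECORD rung — no summit statement is proved here)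

WHY (memo `Cruxes/NearFlatRatioLaw/Lines/ratepack-v3-frozen-g12.md` §5.4–5.5; companion of `…GaussianLayerCake`).  The layer-cake moment bound needs the VOLUME GROWTH
`vol{N ≤ t} ≤ V(t+1)^m` of the Gaussian level `N = β·(quadratic form)` in the gauge variables, i.e. UPPER bounds for the Haar mass of small balls (RED lane A's `…BTHaarFloor`
proves the FLOOR `≥ ρ³/10`).  Via the exponential chart (`Literature/…/T4HaarSU2ExpChart`: Haar = push-forward of `(2π²)⁻¹sinc²‖x‖𝟙_{‖x‖<π}d³x` under `x ↦ exp(ιx)`):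
* `norm_exp_imQuat_sub_one_ge` — `‖exp(ιx) − 1‖ ≥ 2‖x‖/π` for `‖x‖ ≤ π` (`‖exp(ιx) − 1‖² = 4sin²(‖x‖/2)` and Jordan's inequality), so the chart preimage of `quatBall ρ` lies in
  `closedBall(0, πρ/2)`;
* ★ `haarReal_quatBall_le` — `Haar.real{g : ‖q(g) − 1‖ ≤ ρ} ≤ (π²/12)·ρ³` (`ρ ≥ 0`), `haarReal_quatBall_le'` (`≤ ρ³`);
* `gaugeMeasure_real_gaugeCore_le` — `Haar^Λ.real(G_c(ρ)) ≤ (ρ³)^{|Λ|}`.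
HONEST FRAMING: measure bookkeeping; femto rung R2b1 (RECORD label); not infinite volume, not a gap, not Clay.  No defs, no named facts, no `sorry`.
-/

set_option autoImplicit false

noncomputable section

open MeasureTheory Filter Topology Real Metric Set
open scoped BigOperators Matrix Quaternion ENNReal
open Literature.MathematicalPhysics.QuantumFieldTheory
open Literature.MathematicalPhysics.QuantumLattice
open Literature.MathematicalPhysics.QuantumFieldTheory.Balaban1983to89.T4HaarSU2ExpChart

namespace Summit.QuantumFields.YangMills.Theorems.FemtoTransferGap.RateTube

open Summit.QuantumFields.YangMills.Theorems.FemtoTransferGap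
open Summit.QuantumFields.YangMills.Theorems.FemtoTransferGap.TwoLattice
open Summit.QuantumFields.YangMills.Theorems.FemtoTransferGap.TwoLattice.ConstTube
open Summit.QuantumFields.YangMills.Theorems.FemtoTransferGap.TwoLattice.Avg

/-! ## §1 The chart preimage of a small quaternion ball is a small Euclidean ball -/

/-- `‖exp(ιx) − 1‖ ≥ 2‖x‖/π` for `‖x‖ ≤ π` (`‖exp(ιx) − 1‖² = 2 − 2cos‖x‖ = 4sin²(‖x‖/2)`, Jordan `sin t ≥ 2t/π` on `[0, π/2]`). [folklore] -/
theorem norm_exp_imQuat_sub_one_ge {x : EuclideanSpace ℝ (Fin 3)} (hx : ‖x‖ ≤ π) : 2 * ‖x‖ / π ≤ ‖NormedSpace.exp (imQuat x) - 1‖ := by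
  have hn := norm_exp_imQuat x
  have hre := exp_imQuat_re x
  have hns : Quaternion.normSq (NormedSpace.exp (imQuat x)) = 1 := by rw [Quaternion.normSq_eq_norm_mul_self, hn, mul_one]
  have h1 : ‖NormedSpace.exp (imQuat x) - 1‖ ^ 2 = 2 - 2 * Real.cos ‖x‖ := by
    rw [sq, ← Quaternion.normSq_eq_norm_mul_self, Quaternion.normSq_def']
    rw [Quaternion.normSq_def'] at hns
    simp only [Quaternion.re_sub, Quaternion.imI_sub, Quaternion.imJ_sub, Quaternion.imK_sub, Quaternion.re_one, Quaternion.imI_one, Quaternion.imJ_one,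
      Quaternion.imK_one, sub_zero]
    rw [← hre]; nlinarith [hns]
  have hc : Real.cos ‖x‖ = 2 * Real.cos (‖x‖ / 2) ^ 2 - 1 := by rw [← Real.cos_two_mul]; ring_nf
  have hsc : Real.sin (‖x‖ / 2) ^ 2 + Real.cos (‖x‖ / 2) ^ 2 = 1 := Real.sin_sq_add_cos_sq _
  have h2 : ‖NormedSpace.exp (imQuat x) - 1‖ ^ 2 = 4 * Real.sin (‖x‖ / 2) ^ 2 := by rw [h1, hc]; linarith
  have hx0 : 0 ≤ ‖x‖ := norm_nonneg _
  have hj : 2 / π * (‖x‖ / 2) ≤ Real.sin (‖x‖ / 2) := Real.mul_le_sin (by positivity) (by linarith)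
  have hj0 : 0 ≤ 2 / π * (‖x‖ / 2) := by positivity
  have h3 : (2 * ‖x‖ / π) ^ 2 ≤ ‖NormedSpace.exp (imQuat x) - 1‖ ^ 2 := by
    rw [h2]
    have e : (2 * ‖x‖ / π) ^ 2 = 4 * (2 / π * (‖x‖ / 2)) ^ 2 := by ring
    rw [e]
    exact mul_le_mul_of_nonneg_left (pow_le_pow_left₀ hj0 hj 2) (by norm_num)
  exact (pow_le_pow_iff_left₀ (by positivity) (norm_nonneg _) two_ne_zero).mp h3

/-- The chart preimage of `quatBall ρ` inside the chart ball lies in `closedBall(0, πρ/2)`. [folklore] -/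
theorem preimage_expPoint_quatBall_subset (ρ : ℝ) :
    expPoint ⁻¹' quatBall ρ ∩ ball (0 : EuclideanSpace ℝ (Fin 3)) π ⊆ closedBall (0 : EuclideanSpace ℝ (Fin 3)) (π * ρ / 2) := by
  rintro x ⟨hx, hxπ⟩
  rw [mem_preimage, quatBall, mem_setOf_eq, su2Quat_expPoint] at hx
  rw [mem_ball_zero_iff] at hxπ
  rw [mem_closedBall_zero_iff]
  have h := (norm_exp_imQuat_sub_one_ge hxπ.le).trans hx
  rw [div_le_iff₀ Real.pi_pos] at h
  linarith

/-! ## §2 ★ The upper bound -/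

/-- ★ `Haar.real{g : ‖q(g) − 1‖ ≤ ρ} ≤ (π²/12)·ρ³` for `ρ ≥ 0`. [cite: BrockerTomDieck1985, I (5.4)] -/
theorem haarReal_quatBall_le {ρ : ℝ} (hρ : 0 ≤ ρ) : (haarProbability SU2).real (quatBall ρ) ≤ π ^ 2 / 12 * ρ ^ 3 := by
  have hS : MeasurableSet (expPoint ⁻¹' quatBall ρ) := measurable_expPoint (measurableSet_quatBall ρ)
  have hmap : haarProbability SU2 (quatBall ρ) = expMeasure (expPoint ⁻¹' quatBall ρ) := by
    rw [← map_expPoint_expMeasure, Measure.map_apply measurable_expPoint (measurableSet_quatBall ρ)]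
  have hexp : expMeasure (expPoint ⁻¹' quatBall ρ) ≤ ENNReal.ofReal ((2 * π ^ 2)⁻¹) * volume (closedBall (0 : EuclideanSpace ℝ (Fin 3)) (π * ρ / 2)) := by
    rw [expMeasure, withDensity_apply _ hS, Measure.restrict_restrict hS]
    calc ∫⁻ x in expPoint ⁻¹' quatBall ρ ∩ ball (0 : EuclideanSpace ℝ (Fin 3)) π, ENNReal.ofReal (expWeight x)
        ≤ ∫⁻ _ in expPoint ⁻¹' quatBall ρ ∩ ball (0 : EuclideanSpace ℝ (Fin 3)) π, ENNReal.ofReal ((2 * π ^ 2)⁻¹) :=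
          lintegral_mono fun x => ENNReal.ofReal_le_ofReal (expWeight_le x)
      _ = ENNReal.ofReal ((2 * π ^ 2)⁻¹) * volume (expPoint ⁻¹' quatBall ρ ∩ ball (0 : EuclideanSpace ℝ (Fin 3)) π) := by
          rw [setLIntegral_const]
      _ ≤ ENNReal.ofReal ((2 * π ^ 2)⁻¹) * volume (closedBall (0 : EuclideanSpace ℝ (Fin 3)) (π * ρ / 2)) :=
          by gcongr; exact preimage_expPoint_quatBall_subset ρ
  have hvol : volume (closedBall (0 : EuclideanSpace ℝ (Fin 3)) (π * ρ / 2)) = ENNReal.ofReal ((π * ρ / 2) ^ 3 * (π * 4 / 3)) := by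
    rw [Measure.addHaar_closedBall_eq_addHaar_ball, EuclideanSpace.volume_ball_fin_three, ← ENNReal.ofReal_pow (by positivity),
      ← ENNReal.ofReal_mul (by positivity)]
  have hle : haarProbability SU2 (quatBall ρ) ≤ ENNReal.ofReal (π ^ 2 / 12 * ρ ^ 3) := by
    rw [hmap]
    refine hexp.trans ?_
    rw [hvol, ← ENNReal.ofReal_mul (by positivity)]
    refine ENNReal.ofReal_le_ofReal (le_of_eq ?_)
    have hπ : (π : ℝ) ≠ 0 := Real.pi_pos.ne'
    field_simp
    ring
  exact ENNReal.toReal_le_of_le_ofReal (by positivity) hle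

/-- `Haar.real{g : ‖q(g) − 1‖ ≤ ρ} ≤ ρ³` for `ρ ≥ 0` (`π² < 12`). [cite: BrockerTomDieck1985, I (5.4)] -/
theorem haarReal_quatBall_le' {ρ : ℝ} (hρ : 0 ≤ ρ) : (haarProbability SU2).real (quatBall ρ) ≤ ρ ^ 3 := by
  have h := haarReal_quatBall_le hρ
  have hπ : π ^ 2 / 12 ≤ 1 := by
    have h4 := Real.pi_lt_d2
    have h0 := Real.pi_pos
    rw [div_le_one (by norm_num)]; nlinarith
  calc (haarProbability SU2).real (quatBall ρ) ≤ π ^ 2 / 12 * ρ ^ 3 := h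
    _ ≤ 1 * ρ ^ 3 := mul_le_mul_of_nonneg_right hπ (by positivity)
    _ = ρ ^ 3 := one_mul _

/-- The gauge core from above: `Haar^Λ.real(G_c(ρ)) ≤ (ρ³)^{|Λ|}` for `ρ ≥ 0`. [folklore] -/
theorem gaugeMeasure_real_gaugeCore_le (L : ℕ) [NeZero L] {ρ : ℝ} (hρ : 0 ≤ ρ) :
    (gaugeMeasure L).real (gaugeCore L ρ) ≤ (ρ ^ 3) ^ Fintype.card (Site 3 L) := by
  rw [gaugeMeasure_real_gaugeCore]
  exact pow_le_pow_left₀ measureReal_nonneg (haarReal_quatBall_le' hρ) _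

end Summit.QuantumFields.YangMills.Theorems.FemtoTransferGap.RateTube

end
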